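/-
Copyright (c) 2026 the pub-hodgecm-mathlib formalisation cell (harness21).  Prover seat hodgecm-mathlib-LH4-p19 (g3), req620 Track A «(D-RAM) FOUR-FRAME» squad
(STAGE-1b, row (2) of the piece `f_{T₊}`, the (β₂) road (R-36) «PURE-CELL LEDGER»; β₂ WORD #29∕#31 «p19: RAY BANDS» — the E-side label dictionary of an upper-line RAY cell,
the ROOT regime of the affine ray scalar), 2026-09-05.
-/
import Literature.NumberTheory.LocalFields.WildQuadraticDatumNormSignConductor               -- ★ (LH4-p06 (g3)): `normSign_eq_of_near`, `normSign_mul_of_fixed`; brings ★ `normSign`, `IsRamifiedQuadraticDatum`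
import HarnessLib

/-!
# Crux `H413`, line LH4 «(D-RAM) FOUR-FRAME» — STAGE-1b, row (2), the (β₂) road (R-36), (OFF) residue, RAY bands: «THE AFFINE LABEL IN THE ROOT REGIME» — if the slope `θ` is
# `σ`-fixed to `2d − 1` relative digits (`|θ − γ₁| ≤ |γ₁|·|ϖ|^{2d−1}`) and the root `W` is `σ`-fixed to `2d − 1` digits at the sphere's scale (`|γ₁(W − W₁)| ≤ |ϖ|^{2d−1}`), then
# on the sphere `|γ₁(V − W₁)| = 1` every fixed `f` with `|T·θ·(V − W) − f| ≤ |ϖ|^{2d−1}` has `ω(f) = ω(T)·ω(γ₁(V − W₁))`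

Cell `hodgecm-mathlib` (D-0151), FLOOR 0, crux item H413 = `stmt-HodgeConjecture-24833`, route of record `HCCMUnconditional`; squad F0∕P3c∕LH4; lane
`--supports stmt-HodgeConjecture-24833 --as helper` (count-neutral; pays NO tier-0 row).  THEOREMS ONLY (no `def`, no instance, no notation, no `sorry`, default heartbeats);
★-only imports; states NO law; (β₂) stays a HYPOTHESIS.  `E`-side only: a complete sheet datum `IsRamifiedQuadraticDatum σ ϖ d t` with finite residue field (`ω = normSign σ`).

WHY (this seat's RAYBANDS census; β₂ WORD #29 «p19: RAY BANDS»; ★ p863048 `…RayScalarNearlyFixed` HEAD + ★ p862871 `rayScalar_eq_affine`).  A glued vertex of a cone cell has ray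
scalar `e₀ = pw·(â + b̂·V) = pw·b̂·(V − W)` (root `W = −â∕b̂`) and, on the RAY band, value set `VS_{m⋆} = valueSetMod σ ϖ m⋆ (e′ • X₊)` for a fixed unit `e′` with
`|e₀ − e′·t₊| ≤ |ϖ|^{m⋆}` (★ p863048), labelled `+` iff `ω(e′) = 1` (★ `labelPlus_smul_xPlus_iff_exists_norm`).  Dividing by `t₊` (`m⋆ = d%2 + (2d − 1)`, `|t₊| = |ϖ|^{d%2}`):
`|T·θ·(V − W) − e′| ≤ |ϖ|^{2d−1}` with `T = pw·(ϖσϖ)^b` (fixed unit), `θ = b̂∕((ϖσϖ)^b·t₊)`.  On the LIVE ROW the constant term dominates and ★ p862927 ∕ ★ K4 give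
`ω(e′) = ω(T)·ω(α₁ + γ₁V)` by Eisenstein leading coefficients.  On the UPPER LINE (the (OFF) residue's `hU_ray`, `hD_ray`) the regime is the opposite one: the root `W` sits
INSIDE the digit ball and the counted vertices lie on the sphere `|θ(V − W)| = 1` (exact level `ℓ₀`; LH4-p12 (g9)'s `…UpperLineRayLetters`).  There the dictionary needs no
Eisenstein coordinates, only two cell-level smallness letters which the line model provides (this seat's next file: `Θ(μ − ρμ) = −(μ − ρμ)∕det γ₂` gives the slope one,
`ξ₀·jE(W − σW) = N_ρ(μ)∕(jE u₀₀·(μ − ρμ))` + the LOW band `m_c ≤ 2s` gives the root one):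
* §1 `v_mul_eq_of_v_sub_lt` (a relatively small perturbation of the slope does not move `|θ·x|`), `v_centre_iff_of_lt` ∕ `v_centre_le_iff_of_lt` (a small perturbation of the
  root does not move the sphere `|γ₁(V − W)| = 1` nor the ball `≤ 1`).
* §2 HEAD `normSign_eq_mul_of_rootRegime` — `γ₁, W₁, T, V, f` fixed, `|T| = 1`, `|θ − γ₁| ≤ |γ₁|·|ϖ|^{2d−1}`, `|γ₁(W − W₁)| ≤ |ϖ|^{2d−1}`, `|γ₁(V − W₁)| = 1`,
  `|T·θ·(V − W) − f| ≤ |ϖ|^{2d−1}` ⟹ `ω(f) = ω(T)·ω(γ₁(V − W₁))` (`f` is `|ϖ|^{2d−1}`-close to the fixed unit `T·γ₁(V − W₁)`: ★ `normSign_eq_of_near` at the conductor digit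
  `2d − 1`, then ★ `normSign_mul_of_fixed`).
WHAT IS NOT CLAIMED: the identification of `θ, W, γ₁, W₁` for a cell (this seat's line-model file), the existence of `e′` (★ p863048), any count (★ `…SphereLabelDigits`).
HONEST LABEL.  Count-neutral `E`-algebra; nothing printed is asserted; no census law is stated; `hU_ray`, `hD_ray`, `hL_ray` stay OPEN; `HC_CM` is proved only modulo the 7 printed
citations (2 remaining named inputs: hLiu418 = `stmt-HodgeConjecture-24832`, h413 = `stmt-HodgeConjecture-24833`) until rung 0 closes.
## References
* [Serre1979] J.-P. Serre, *Local Fields*, GTM 67 (1979): Ch. V §3 Cor. 3 pp. 85–87 (conductor `2d − 1` of `ω` on `U_F`), Ch. XV §2 (the norm residue symbol on `U^{(n)}`).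
* [Rogawski1990] J. D. Rogawski, *Automorphic Representations of Unitary Groups in Three Variables*, Ann. of Math. Stud. 123 (1990): §4.9 Prop. 4.9.1 (b) p. 55 (the label `κ`).
* [LanglandsShelstad1987] R. P. Langlands, D. Shelstad, *On the definition of transfer factors*, Math. Ann. 278 (1987): §1–§3.
-/

set_option autoImplicit false

noncomputable section

namespace Summit.HodgeConjecture.HodgeConjecture.Cruxes.H413.F0P3cDyRamRootRegimeAffineLabel

open scoped Valued WithZero
open WithZero
open Literature.NumberTheory.Automorphic.UnitaryThreeFourFrame (IsRamifiedQuadraticDatum normSign)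
open Literature.NumberTheory.LocalFields.WildQuadraticDatum (normSign_eq_of_near normSign_mul_of_fixed)

variable {K : Type} [Field K] [Valued K ℤᵐ⁰] {σ : K →+* K} {ϖ : K} {d t : ℕ}

/-! ## §1 Small perturbations of the slope and of the root -/

/-- **A RELATIVELY SMALL PERTURBATION OF THE SLOPE DOES NOT MOVE SIZES**: `|θ − γ₁| < |γ₁|` ⟹ `|θ·x| = |γ₁·x|`. [cite: Serre1979, Ch. XV §2] -/
theorem v_mul_eq_of_v_sub_lt {θ γ₁ : K} (h : Valued.v (θ - γ₁) < Valued.v γ₁) (x : K) : Valued.v (θ * x) = Valued.v (γ₁ * x) := by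
  by_cases hx : x = 0
  · rw [hx, mul_zero, mul_zero]
  have hxpos : (0 : ℤᵐ⁰) < Valued.v x := zero_lt_iff.2 ((Valuation.ne_zero_iff _).2 hx)
  have e : θ * x = γ₁ * x + (θ - γ₁) * x := by ring
  rw [e, Valuation.map_add_eq_of_lt_left _ (by rw [Valuation.map_mul, Valuation.map_mul]; exact mul_lt_mul_of_pos_right h hxpos)]

/-- **A SMALL PERTURBATION OF THE ROOT DOES NOT MOVE THE SPHERE**: `|γ₁(W − W₁)| < 1` ⟹ (`|γ₁(V − W)| = 1 ↔ |γ₁(V − W₁)| = 1`). [cite: Serre1979, Ch. XV §2] -/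
theorem v_centre_iff_of_lt {γ₁ W W₁ : K} (h : Valued.v (γ₁ * (W - W₁)) < 1) (V : K) :
    Valued.v (γ₁ * (V - W)) = 1 ↔ Valued.v (γ₁ * (V - W₁)) = 1 := by
  have e₁ : γ₁ * (V - W₁) = γ₁ * (V - W) + γ₁ * (W - W₁) := by ring
  have e₂ : γ₁ * (V - W) = γ₁ * (V - W₁) - γ₁ * (W - W₁) := by ring
  constructor
  · intro h1
    rw [e₁, Valuation.map_add_eq_of_lt_left _ (by rw [h1]; exact h), h1]
  · intro h1
    rw [e₂, Valuation.map_sub_eq_of_lt_left _ (by rw [h1]; exact h), h1]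

/-- … NOR THE BALL: `|γ₁(W − W₁)| ≤ 1` ⟹ (`|γ₁(V − W)| ≤ 1 ↔ |γ₁(V − W₁)| ≤ 1`). [cite: Serre1979, Ch. XV §2] -/
theorem v_centre_le_iff_of_le {γ₁ W W₁ : K} (h : Valued.v (γ₁ * (W - W₁)) ≤ 1) (V : K) :
    Valued.v (γ₁ * (V - W)) ≤ 1 ↔ Valued.v (γ₁ * (V - W₁)) ≤ 1 := by
  have e₁ : γ₁ * (V - W₁) = γ₁ * (V - W) + γ₁ * (W - W₁) := by ring
  have e₂ : γ₁ * (V - W) = γ₁ * (V - W₁) - γ₁ * (W - W₁) := by ring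
  constructor
  · intro h1; rw [e₁]; exact (Valuation.map_add _ _ _).trans (max_le h1 h)
  · intro h1; rw [e₂]; exact (Valuation.map_sub _ _ _).trans (max_le h1 h)

/-! ## §2 HEAD — the dictionary in the root regime -/

/-- **HEAD — «THE AFFINE LABEL IN THE ROOT REGIME».**  At a complete sheet datum with finite residue field: `γ₁, W₁, T, V, f` fixed, `|T| = 1`; the SLOPE letter
`|θ − γ₁| ≤ |γ₁|·|ϖ|^{2d−1}`, the ROOT letter `|γ₁(W − W₁)| ≤ |ϖ|^{2d−1}`, the SPHERE `|γ₁(V − W₁)| = 1` and the NEAR letter `|T·θ·(V − W) − f| ≤ |ϖ|^{2d−1}`.  THEN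
`ω(f) = ω(T)·ω(γ₁(V − W₁))` — `f` and the fixed unit `T·γ₁(V − W₁)` agree to the conductor digit `2d − 1` (★ `normSign_eq_of_near`), and `ω` is multiplicative on the fixed
elements (★ `normSign_mul_of_fixed`). [cite: Serre1979, Ch. V §3 Cor. 3 pp. 85–87; Ch. XV §2] [cite: Rogawski1990, §4.9 Prop. 4.9.1 (b) p. 55] [cite: LanglandsShelstad1987, §1–§3] -/
theorem normSign_eq_mul_of_rootRegime [CompleteSpace K] [Finite 𝓀[K]] (hD : IsRamifiedQuadraticDatum σ ϖ d t)
    {θ W γ₁ W₁ T V f : K} (hσγ : σ γ₁ = γ₁) (hσW₁ : σ W₁ = W₁) (hσT : σ T = T) (hT : Valued.v T = 1) (hσV : σ V = V) (hσf : σ f = f)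
    (hθ : Valued.v (θ - γ₁) ≤ Valued.v γ₁ * Valued.v ϖ ^ (2 * d - 1)) (hW : Valued.v (γ₁ * (W - W₁)) ≤ Valued.v ϖ ^ (2 * d - 1))
    (hsph : Valued.v (γ₁ * (V - W₁)) = 1) (hnear : Valued.v (T * (θ * (V - W)) - f) ≤ Valued.v ϖ ^ (2 * d - 1)) :
    normSign σ f = normSign σ T * normSign σ (γ₁ * (V - W₁)) := by
  obtain ⟨hσσ, hvσ, hϖ, -, -, hd1, -⟩ := id hD
  have hvϖ0 : Valued.v ϖ ≠ 0 := by rw [hϖ]; exact exp_ne_zero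
  have hϖlt : Valued.v ϖ < 1 := by rw [hϖ, ← exp_zero, exp_lt_exp]; norm_num
  have hsmall : Valued.v ϖ ^ (2 * d - 1) < 1 := pow_lt_one₀ zero_le hϖlt (by omega)
  -- `γ₁ ≠ 0`, `T ≠ 0`, the label value is a unit
  have hγ0 : γ₁ ≠ 0 := fun h0 => by rw [h0, zero_mul, map_zero] at hsph; exact zero_ne_one hsph
  have hγpos : (0 : ℤᵐ⁰) < Valued.v γ₁ := zero_lt_iff.2 ((Valuation.ne_zero_iff _).2 hγ0)
  have hT0 : T ≠ 0 := fun h0 => by rw [h0, map_zero] at hT; exact zero_ne_one hT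
  have hg0 : γ₁ * (V - W₁) ≠ 0 := fun h0 => by rw [h0, map_zero] at hsph; exact zero_ne_one hsph
  -- the sphere through the true root
  have hWlt : Valued.v (γ₁ * (W - W₁)) < 1 := hW.trans_lt hsmall
  have hsphW : Valued.v (γ₁ * (V - W)) = 1 := (v_centre_iff_of_lt hWlt V).2 hsph
  -- the two perturbation terms
  have hθlt : Valued.v (θ - γ₁) < Valued.v γ₁ := by
    calc Valued.v (θ - γ₁) ≤ Valued.v γ₁ * Valued.v ϖ ^ (2 * d - 1) := hθ
      _ < Valued.v γ₁ * 1 := mul_lt_mul_of_pos_left hsmall hγpos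
      _ = Valued.v γ₁ := mul_one _
  have h1 : Valued.v ((θ - γ₁) * (V - W)) ≤ Valued.v ϖ ^ (2 * d - 1) := by
    have hVW : Valued.v (V - W) = (Valued.v γ₁)⁻¹ := by
      have := hsphW
      rw [Valuation.map_mul] at this
      exact eq_inv_of_mul_eq_one_right this
    rw [Valuation.map_mul, hVW]
    calc Valued.v (θ - γ₁) * (Valued.v γ₁)⁻¹ ≤ Valued.v γ₁ * Valued.v ϖ ^ (2 * d - 1) * (Valued.v γ₁)⁻¹ := by gcongr
      _ = Valued.v ϖ ^ (2 * d - 1) := by rw [mul_comm, ← mul_assoc, inv_mul_cancel₀ hγpos.ne', one_mul]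
  have hclose : Valued.v (T * (γ₁ * (V - W₁)) - f) ≤ Valued.v ϖ ^ (2 * d - 1) := by
    have e : T * (γ₁ * (V - W₁)) - f = (T * (θ * (V - W)) - f) - T * ((θ - γ₁) * (V - W) - γ₁ * (W - W₁)) := by ring
    rw [e]
    refine (Valuation.map_sub _ _ _).trans (max_le hnear ?_)
    rw [Valuation.map_mul, hT, one_mul]
    exact (Valuation.map_sub _ _ _).trans (max_le h1 hW)
  -- ★ conductor digit + multiplicativity
  have hσg : σ (T * (γ₁ * (V - W₁))) = T * (γ₁ * (V - W₁)) := by rw [map_mul, map_mul, map_sub, hσT, hσγ, hσV, hσW₁]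
  have hg1 : Valued.v (T * (γ₁ * (V - W₁))) = 1 := by rw [Valuation.map_mul, hT, hsph, one_mul]
  rw [normSign_eq_of_near hD hσg hσf hg1 (n := 2 * d - 1) le_rfl hclose,
    normSign_mul_of_fixed hD hσT (by rw [map_mul, map_sub, hσγ, hσV, hσW₁]) hT0 hg0]

end Summit.HodgeConjecture.HodgeConjecture.Cruxes.H413.F0P3cDyRamRootRegimeAffineLabel

end
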